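import Mathlib
import Literature.InformationTheory.Coding.MacWilliamsIdentity
import HarnessLib

/-!
# Orthogonality and symmetry of the binary Krawtchouk polynomials

Topic `Literature/InformationTheory/Coding`. The algebraic toolkit of MacWilliams–Sloane
[MacWilliamsSloane1977, Ch. 5 §7] for the binary (`q = 2`, `γ = 1`) Krawtchouk polynomials
`K_k(x) = Σ_j (-1)^j C(x,j) C(n-x,k-j)` of `DelsarteLPBound` (`krawtchouk n k x`), proved through the
`±1` characters `χ_S(z) = ∏_{i ∈ S} (-1)^{z_i}` of `F^n = (Fin n → Bool)` (`signChar`) and Delsarte's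
lemma `Σ_{|S| = k} χ_S(z) = K_k(wt z)` (`sum_signChar_eq_krawtchouk`) [Ch. 5 §4 (27), Problem (14)],
together with the words/supports dictionary (`wt`, `indWord`, `dotSign`, `perpCode`, `weightCount`) of
`MacWilliamsIdentity`:

* `sum_signChar_mul_signChar` — orthogonality of characters on `F^n`:
  `Σ_{z ∈ F^n} χ_S(z) χ_T(z) = 2^n [S = T]` [Ch. 5 §4 Problems (12)(iv), (13) with `C = F^n`];
  `card_filter_wt_eq_choose` — there are `C(n,i)` words of weight `i`.
* `sum_choose_mul_krawtchouk_mul_krawtchouk` — **Theorem 16** (orthogonality relations, (58)):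
  `Σ_{i=0}^{n} C(n,i) K_r(i) K_s(i) = 2^n C(n,r) δ_{r,s}`.
* `choose_mul_krawtchouk_comm` — **Theorem 17** ((59)): `C(n,i) K_s(i) = C(n,s) K_i(s)`.
* `sum_krawtchouk_mul_krawtchouk` — **Corollary 18**: `Σ_{i=0}^{n} K_r(i) K_i(s) = 2^n δ_{r,s}`;
  `sum_krawtchouk_left` — Problem (45): `Σ_{i=0}^{n} K_i(k) = 2^n δ_{k,0}`.
* `krawtchouk_expansion_coeff` — **Theorem 20** ((61)): the coefficients of a Krawtchouk expansion
  `α(i) = Σ_k a_k K_k(i)` (`0 ≤ i ≤ n`) satisfy `2^n a_k = Σ_i α(i) K_i(k)`.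
* `krawtchouk_sub` / `krawtchouk_self` — Problems (43), (44): `K_{n-k}(i) = (-1)^i K_k(i)`,
  `K_n(i) = (-1)^i` (via the complementary characters `χ_{Sᶜ} = (-1)^{wt} χ_S`).

All statements are over `ℤ` and cleared of denominators.

References. [MacWilliamsSloane1977] F. J. MacWilliams, N. J. A. Sloane, *The Theory of
Error-Correcting Codes*, North-Holland 1977 — Ch. 5 §4 ((27), (28), Problems (12)–(14)), §7
((53), (54), (57), Thm. 16 (58), Thm. 17 (59), Cor. 18, Thm. 20 (61), Problems (43)–(45)).
-/

open Finset

namespace Literature.InformationTheory.Coding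

variable {n : ℕ}

/-! ## 1. Words of a given weight -/

/-- A sum over the words of weight `i` is a sum over the `i`-subsets of `[n]` (their supports).
[cite: MacWilliamsSloane1977, Ch. 5 §7 Thm. 16 (58) (the factor `C(n,i) γ^i` counts the words of
weight `i`)] -/
theorem sum_filter_wt_eq_sum_powersetCard {M : Type*} [AddCommMonoid M] (i : ℕ)
    (g : (Fin n → Bool) → M) :
    ∑ z ∈ univ.filter (fun z : Fin n → Bool => wt z = i), g z
      = ∑ T ∈ powersetCard i (univ : Finset (Fin n)), g (indWord T) := by
  refine Finset.sum_bij' (fun z _ => univ.filter fun j => z j = true) (fun T _ => indWord T)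
    ?_ ?_ ?_ ?_ ?_
  · intro z hz
    rw [mem_filter] at hz
    exact mem_powersetCard.mpr ⟨subset_univ _, hz.2⟩
  · intro T hT
    rw [mem_filter]
    exact ⟨mem_univ _, by rw [wt_indWord]; exact (mem_powersetCard.mp hT).2⟩
  · intro z _
    exact indWord_filter z
  · intro T _
    exact filter_indWord T
  · intro z _
    rw [indWord_filter]

/-- **There are `C(n,i)` binary words of length `n` and weight `i`.**
[cite: MacWilliamsSloane1977, Ch. 5 §7 Thm. 16 (58)] -/
theorem card_filter_wt_eq_choose (i : ℕ) :
    #(univ.filter fun z : Fin n → Bool => wt z = i) = n.choose i := by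
  have h := sum_filter_wt_eq_sum_powersetCard (n := n) i (fun _ => (1 : ℕ))
  simp only [sum_const, smul_eq_mul, mul_one, card_powersetCard, card_univ, Fintype.card_fin] at h
  exact h

/-- The weight distribution of the whole space: `A_i(F^n) = C(n,i)`.
[cite: MacWilliamsSloane1977, Ch. 5 §7 Thm. 16 (58)] -/
theorem weightCount_univ (i : ℕ) : weightCount (univ : Finset (Fin n → Bool)) i = n.choose i :=
  card_filter_wt_eq_choose i

/-- Regrouping a sum over `F^n` by weight: `Σ_{z ∈ F^n} g(wt z) = Σ_{i=0}^{n} C(n,i) g(i)`.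
[cite: MacWilliamsSloane1977, Ch. 5 §7 Thm. 16 (58)] -/
theorem sum_univ_wt_eq_sum_choose {M : Type*} [AddCommMonoid M] (g : ℕ → M) :
    ∑ z : Fin n → Bool, g (wt z) = ∑ i ∈ range (n + 1), n.choose i • g i := by
  rw [sum_eq_sum_weightCount]
  exact sum_congr rfl fun i _ => by rw [weightCount_univ]

/-- Beyond degree `n` the character sums are empty: `K_k(i) = 0` for `i ≤ n < k`.
[cite: MacWilliamsSloane1977, Ch. 5 §7 eqs. (53), (54)] -/
theorem krawtchouk_eq_zero_of_length_lt {k i : ℕ} (hk : n < k) (hi : i ≤ n) :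
    krawtchouk n k i = 0 := by
  obtain ⟨T, hT⟩ : (powersetCard i (univ : Finset (Fin n))).Nonempty := by
    rw [powersetCard_nonempty]
    simpa using hi
  have hw : #{j | indWord T j = true} = i := by
    rw [show #{j | indWord T j = true} = #T from wt_indWord T, (mem_powersetCard.mp hT).2]
  rw [← hw, ← sum_signChar_eq_krawtchouk, powersetCard_eq_empty.mpr (by simpa using hk),
    sum_empty]

/-! ## 2. Orthogonality of the characters of `F^n` -/

/-- `F^n` itself is a linear code. [cite: MacWilliamsSloane1977, Ch. 1 §8] -/
theorem isLinearCode_univ : IsLinearCode (univ : Finset (Fin n → Bool)) :=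
  ⟨⟨fun _ => false, mem_univ _⟩, fun _ _ _ _ => mem_univ _⟩

/-- `(F^n)⊥ = {0}`: a word orthogonal to every unit vector is zero.
[cite: MacWilliamsSloane1977, Ch. 1 §8 eq. (42)] -/
theorem perpCode_univ : perpCode (univ : Finset (Fin n → Bool)) = {fun _ => false} := by
  refine Subset.antisymm ?_ (singleton_subset_iff.mpr (zero_mem_perpCode _))
  intro v hv
  rw [mem_singleton]
  funext j
  have h := mem_perpCode.mp hv (indWord {j}) (mem_univ _)
  rw [dotSign_indWord, signChar, prod_singleton] at h
  revert h
  cases v j <;> simp [bitSign]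

/-- `Σ_{u ∈ F^n} (-1)^{u·v} = 2^n [v = 0]`. [cite: MacWilliamsSloane1977, Ch. 5 §4 Problem (13)
(with `C = F^n`, `C⊥ = {0}`)] -/
theorem sum_dotSign_univ (v : Fin n → Bool) :
    ∑ u : Fin n → Bool, dotSign u v = if v = (fun _ => false) then 2 ^ n else 0 := by
  rw [sum_dotSign_eq isLinearCode_univ v, perpCode_univ]
  simp [mem_singleton, card_univ, Fintype.card_bool, Fintype.card_fin]

/-- `Σ_{z ∈ F^n} χ_S(z) = 2^n [S = ∅]`. [cite: MacWilliamsSloane1977, Ch. 5 §4 Problem (13)] -/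
theorem sum_signChar_univ (S : Finset (Fin n)) :
    ∑ z : Fin n → Bool, signChar S z = if S = ∅ then 2 ^ n else 0 := by
  have h := sum_dotSign_univ (n := n) (indWord S)
  simp_rw [dotSign_comm _ (indWord S), dotSign_indWord] at h
  rw [h]
  have hiff : indWord S = (fun _ => false) ↔ S = ∅ := by
    constructor
    · intro h0
      rw [← filter_indWord S, h0]
      ext j
      simp
    · rintro rfl
      funext j
      simp [indWord]
  by_cases hS : S = ∅
  · rw [if_pos hS, if_pos (hiff.mpr hS)]
  · rw [if_neg hS, if_neg fun h0 => hS (hiff.mp h0)]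

/-- A character as a product over all coordinates. [cite: MacWilliamsSloane1977, Ch. 5 §4 (27)] -/
theorem signChar_eq_prod_ite (U : Finset (Fin n)) (z : Fin n → Bool) :
    signChar U z = ∏ i, if i ∈ U then bitSign (z i) else 1 := by
  rw [signChar, ← Finset.prod_filter]
  congr 1
  ext i
  simp

/-- `χ_S(z) χ_T(z) = χ_{S Δ T}(z)` (`χ_u χ_v = χ_{u+v}`, the supports adding by symmetric
difference). [cite: MacWilliamsSloane1977, Ch. 5 §4 Problem (12)(iv)] -/
theorem signChar_mul_signChar_eq_symmDiff (S T : Finset (Fin n)) (z : Fin n → Bool) :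
    signChar S z * signChar T z = signChar (symmDiff S T) z := by
  rw [signChar_eq_prod_ite S, signChar_eq_prod_ite T, signChar_eq_prod_ite (symmDiff S T),
    ← prod_mul_distrib]
  refine prod_congr rfl fun i _ => ?_
  by_cases hS : i ∈ S <;> by_cases hT : i ∈ T <;>
    simp [hS, hT, Finset.mem_symmDiff, bitSign_mul_self]

/-- **Orthogonality of the characters of `F^n`:** `Σ_{z ∈ F^n} χ_S(z) χ_T(z) = 2^n [S = T]`.
[cite: MacWilliamsSloane1977, Ch. 5 §4 Problems (12)(iv), (13)] -/
theorem sum_signChar_mul_signChar (S T : Finset (Fin n)) :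
    ∑ z : Fin n → Bool, signChar S z * signChar T z = if S = T then 2 ^ n else 0 := by
  simp_rw [signChar_mul_signChar_eq_symmDiff]
  rw [sum_signChar_univ]
  have hiff : symmDiff S T = ∅ ↔ S = T := by
    rw [← Finset.bot_eq_empty, symmDiff_eq_bot]
  by_cases hST : S = T
  · rw [if_pos hST, if_pos (hiff.mpr hST)]
  · rw [if_neg hST, if_neg fun h0 => hST (hiff.mp h0)]

/-! ## 3. Theorem 16: orthogonality relations -/

/-- **Theorem 16 (orthogonality relations), binary case:**
`Σ_{i=0}^{n} C(n,i) K_r(i) K_s(i) = 2^n C(n,r) δ_{r,s}` (expand both Krawtchouk values over the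
words of each weight as character sums and use the orthogonality of characters).
[cite: MacWilliamsSloane1977, Ch. 5 §7 Thm. 16 eq. (58) (q = 2)] -/
theorem sum_choose_mul_krawtchouk_mul_krawtchouk (r s : ℕ) :
    ∑ i ∈ range (n + 1), (n.choose i : ℤ) * (krawtchouk n r i * krawtchouk n s i)
      = if r = s then 2 ^ n * (n.choose r : ℤ) else 0 := by
  -- regroup the sum over `F^n` by weight
  have h1 : ∑ z : Fin n → Bool, krawtchouk n r (wt z) * krawtchouk n s (wt z)
      = ∑ i ∈ range (n + 1), (n.choose i : ℤ) * (krawtchouk n r i * krawtchouk n s i) := by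
    rw [sum_univ_wt_eq_sum_choose (fun i => krawtchouk n r i * krawtchouk n s i)]
    simp only [nsmul_eq_mul]
  rw [← h1]
  -- expand both Krawtchouk values as character sums and use orthogonality
  have h2 : ∀ z : Fin n → Bool, krawtchouk n r (wt z) * krawtchouk n s (wt z)
      = ∑ S ∈ powersetCard r (univ : Finset (Fin n)), ∑ T ∈ powersetCard s univ,
          signChar S z * signChar T z := by
    intro z
    unfold wt
    rw [← sum_signChar_eq_krawtchouk, ← sum_signChar_eq_krawtchouk, sum_mul_sum]
  simp_rw [h2]
  rw [sum_comm]
  have h3 : ∀ S : Finset (Fin n),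
      ∑ z : Fin n → Bool, ∑ T ∈ powersetCard s (univ : Finset (Fin n)), signChar S z * signChar T z
        = ∑ T ∈ powersetCard s (univ : Finset (Fin n)), (if S = T then (2 : ℤ) ^ n else 0) := by
    intro S
    rw [sum_comm]
    exact sum_congr rfl fun T _ => sum_signChar_mul_signChar S T
  simp_rw [h3, sum_ite_eq]
  split_ifs with hrs
  · subst hrs
    rw [sum_congr rfl (fun S hS => if_pos hS), sum_const, card_powersetCard, card_univ,
      Fintype.card_fin, nsmul_eq_mul, mul_comm]
  · exact sum_eq_zero fun S hS => if_neg fun hS' =>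
      hrs (((mem_powersetCard.mp hS).2).symm.trans (mem_powersetCard.mp hS').2)

/-! ## 4. Theorem 17: symmetry -/

/-- `χ_S(1_T) = χ_T(1_S)` (`= (-1)^{|S ∩ T|}`). [cite: MacWilliamsSloane1977, Ch. 5 §4 Problem (12)(i)] -/
theorem signChar_indWord_comm (S T : Finset (Fin n)) :
    signChar S (indWord T) = signChar T (indWord S) := by
  rw [← dotSign_indWord, ← dotSign_indWord, dotSign_comm]

/-- **Theorem 17 (symmetry), binary case:** `C(n,i) K_s(i) = C(n,s) K_i(s)` (count
`Σ_{|T| = i} Σ_{|S| = s} (-1)^{|S ∩ T|}` in the two orders).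
[cite: MacWilliamsSloane1977, Ch. 5 §7 Thm. 17 eq. (59) (q = 2)] -/
theorem choose_mul_krawtchouk_comm (i s : ℕ) :
    (n.choose i : ℤ) * krawtchouk n s i = (n.choose s : ℤ) * krawtchouk n i s := by
  have inner : ∀ a b : ℕ, ∀ T ∈ powersetCard a (univ : Finset (Fin n)),
      ∑ S ∈ powersetCard b (univ : Finset (Fin n)), signChar S (indWord T) = krawtchouk n b a := by
    intro a b T hT
    rw [sum_signChar_eq_krawtchouk, show #{j | indWord T j = true} = #T from wt_indWord T,
      (mem_powersetCard.mp hT).2]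
  have key : ∀ a b : ℕ, (n.choose a : ℤ) * krawtchouk n b a
      = ∑ T ∈ powersetCard a (univ : Finset (Fin n)), ∑ S ∈ powersetCard b univ,
          signChar S (indWord T) := by
    intro a b
    rw [sum_congr rfl (inner a b), sum_const, card_powersetCard, card_univ, Fintype.card_fin,
      nsmul_eq_mul]
  rw [key i s, key s i, sum_comm]
  exact sum_congr rfl fun x _ => sum_congr rfl fun y _ => signChar_indWord_comm _ _

/-! ## 5. Corollary 18, Problem (45) and the expansion formula (Theorem 20) -/

/-- **Corollary 18, binary case:** `Σ_{i=0}^{n} K_r(i) K_i(s) = 2^n δ_{r,s}` (`0 ≤ s ≤ n`).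
[cite: MacWilliamsSloane1977, Ch. 5 §7 Cor. 18] -/
theorem sum_krawtchouk_mul_krawtchouk (r : ℕ) {s : ℕ} (hs : s ≤ n) :
    ∑ i ∈ range (n + 1), krawtchouk n r i * krawtchouk n i s = if r = s then 2 ^ n else 0 := by
  have hpos : (n.choose s : ℤ) ≠ 0 := by exact_mod_cast (Nat.choose_pos hs).ne'
  have h : (n.choose s : ℤ) * ∑ i ∈ range (n + 1), krawtchouk n r i * krawtchouk n i s
      = ∑ i ∈ range (n + 1), (n.choose i : ℤ) * (krawtchouk n r i * krawtchouk n s i) := by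
    rw [mul_sum]
    refine sum_congr rfl fun i _ => ?_
    rw [mul_left_comm, ← choose_mul_krawtchouk_comm i s]
    ring
  rw [sum_choose_mul_krawtchouk_mul_krawtchouk] at h
  split_ifs at h ⊢ with hrs
  · subst hrs
    exact mul_left_cancel₀ hpos (h.trans (mul_comm _ _))
  · exact (mul_eq_zero.mp h).resolve_left hpos

/-- **Problem (45):** `Σ_{i=0}^{n} K_i(k) = 2^n δ_{k,0}` (`0 ≤ k ≤ n`).
[cite: MacWilliamsSloane1977, Ch. 5 §7 Problem (45)] -/
theorem sum_krawtchouk_left {k : ℕ} (hk : k ≤ n) :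
    ∑ i ∈ range (n + 1), krawtchouk n i k = if k = 0 then 2 ^ n else 0 := by
  have h := sum_krawtchouk_mul_krawtchouk (n := n) 0 hk
  simp only [krawtchouk_zero_left, one_mul] at h
  rw [h]
  rcases eq_or_ne k 0 with rfl | hk0
  · simp
  · rw [if_neg (Ne.symm hk0), if_neg hk0]

/-- **Theorem 20 (Krawtchouk expansion), binary case:** if `α(i) = Σ_{k=0}^{n} a_k K_k(i)` for
`0 ≤ i ≤ n`, then `2^n a_k = Σ_{i=0}^{n} α(i) K_i(k)` for `0 ≤ k ≤ n` (multiply by `K_i(k)`, sum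
over `i` and use Corollary 18). [cite: MacWilliamsSloane1977, Ch. 5 §7 Thm. 20 eq. (61)] -/
theorem krawtchouk_expansion_coeff {a α : ℕ → ℤ}
    (hα : ∀ i, i ≤ n → α i = ∑ k ∈ range (n + 1), a k * krawtchouk n k i) {k : ℕ} (hk : k ≤ n) :
    2 ^ n * a k = ∑ i ∈ range (n + 1), α i * krawtchouk n i k := by
  have hk' : k ∈ range (n + 1) := mem_range.mpr (Nat.lt_succ_of_le hk)
  symm
  calc ∑ i ∈ range (n + 1), α i * krawtchouk n i k
      = ∑ i ∈ range (n + 1), ∑ l ∈ range (n + 1),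
          a l * (krawtchouk n l i * krawtchouk n i k) := by
        refine sum_congr rfl fun i hi => ?_
        rw [hα i (Nat.lt_succ_iff.mp (mem_range.mp hi)), sum_mul]
        exact sum_congr rfl fun l _ => mul_assoc _ _ _
    _ = ∑ l ∈ range (n + 1), a l * ∑ i ∈ range (n + 1), krawtchouk n l i * krawtchouk n i k := by
        rw [sum_comm]
        exact sum_congr rfl fun l _ => (mul_sum _ _ _).symm
    _ = ∑ l ∈ range (n + 1), (if l = k then a l * 2 ^ n else 0) := by
        refine sum_congr rfl fun l _ => ?_
        rw [sum_krawtchouk_mul_krawtchouk l hk]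
        split_ifs <;> simp
    _ = 2 ^ n * a k := by rw [sum_ite_eq', if_pos hk', mul_comm]

/-! ## 6. Complementary characters: Problems (43), (44) -/

/-- `χ_{[n]}(z) = (-1)^{wt z}`. [cite: MacWilliamsSloane1977, Ch. 5 §4 (27)] -/
theorem signChar_univ_eq (z : Fin n → Bool) : signChar univ z = (-1) ^ wt z := by
  unfold signChar bitSign
  rw [Finset.prod_ite, prod_const, prod_const, one_pow, mul_one]
  rfl

/-- `χ_{Sᶜ}(z) = (-1)^{wt z} χ_S(z)`. [cite: MacWilliamsSloane1977, Ch. 5 §4 (27), Problem (12)(iv)] -/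
theorem signChar_compl (S : Finset (Fin n)) (z : Fin n → Bool) :
    signChar Sᶜ z = (-1) ^ wt z * signChar S z := by
  have h := Finset.prod_mul_prod_compl S (fun i => bitSign (z i))
  change signChar S z * signChar Sᶜ z = signChar univ z at h
  rw [signChar_univ_eq] at h
  calc signChar Sᶜ z = signChar S z * signChar S z * signChar Sᶜ z := by
        rw [signChar_mul_self, one_mul]
    _ = signChar S z * (-1) ^ wt z := by rw [mul_assoc, h]
    _ = (-1) ^ wt z * signChar S z := mul_comm _ _

/-- **Problem (43):** `K_{n-k}(i) = (-1)^i K_k(i)` for `0 ≤ i, k ≤ n` (complementation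
`S ↦ Sᶜ` of the supports). [cite: MacWilliamsSloane1977, Ch. 5 §7 Problem (43)] -/
theorem krawtchouk_sub {k i : ℕ} (hk : k ≤ n) (hi : i ≤ n) :
    krawtchouk n (n - k) i = (-1) ^ i * krawtchouk n k i := by
  obtain ⟨T, hT⟩ : (powersetCard i (univ : Finset (Fin n))).Nonempty := by
    rw [powersetCard_nonempty]
    simpa using hi
  have hw : #{j | indWord T j = true} = i := by
    rw [show #{j | indWord T j = true} = #T from wt_indWord T, (mem_powersetCard.mp hT).2]
  rw [← hw, ← sum_signChar_eq_krawtchouk, ← sum_signChar_eq_krawtchouk, mul_sum]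
  symm
  refine Finset.sum_bij' (fun S _ => Sᶜ) (fun S _ => Sᶜ) ?_ ?_ ?_ ?_ ?_
  · intro S hS
    rw [mem_powersetCard] at hS ⊢
    refine ⟨subset_univ _, ?_⟩
    rw [Finset.card_compl, Fintype.card_fin, hS.2]
  · intro S hS
    rw [mem_powersetCard] at hS ⊢
    refine ⟨subset_univ _, ?_⟩
    rw [Finset.card_compl, Fintype.card_fin, hS.2]
    omega
  · intro S _
    exact compl_compl S
  · intro S _
    exact compl_compl S
  · intro S _
    exact (signChar_compl S _).symm

/-- **Problem (44):** `K_n(i) = (-1)^i` for `0 ≤ i ≤ n`. [cite: MacWilliamsSloane1977, Ch. 5 §7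
Problem (44)] -/
theorem krawtchouk_self {i : ℕ} (hi : i ≤ n) : krawtchouk n n i = (-1) ^ i := by
  have h := krawtchouk_sub (n := n) (k := 0) (Nat.zero_le n) hi
  rw [Nat.sub_zero, krawtchouk_zero_left, mul_one] at h
  exact h

end Literature.InformationTheory.Coding
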